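import Summits.BirchSwinnertonDyer.BirchSwinnertonDyer.Theorems.GoldfeldAllTwistsTwoConverseTwinEvenTwistLValuePOneAlpha
import Summits.BirchSwinnertonDyer.BirchSwinnertonDyer.Theorems.GoldfeldAllTwistsTwoConverseTwinSplitTwistLValuePOne
import Summits.BirchSwinnertonDyer.BirchSwinnertonDyer.Theorems.GoldfeldAllTwistsTwoConverseTwinEvenTwistLValue
import HarnessLib

set_option linter.dupNamespace false -- namespace `…BirchSwinnertonDyer.BirchSwinnertonDyer…` is the cell's (D-0017 nested layout)
set_option autoImplicit false

/-!
# The type-α PARTNER INPUTS for every `p ≡ 1 (mod 4)`: `49a1^{(p)}` (`σ(p) = −1`) and `49a1^{(2p)}` (type α) — descent, `Ш[2] = 0`, `ord₂ L^{alg}` —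
# as `p mod 8`-dichotomy wrappers of the landed `p ≡ 5 (8)` files (LINE C3, c301's U3) and their `p ≡ 1 (8)` twins (D1/D2 of ORDER (ccclx))

Cell `bsd-goldfeld`, seat `bsd-goldfeld-s1p-c3x` (gen 13); planner RULING (ccclx) «OBJECT C7A BY THE χ_Z CHANNEL», tranche P, file P0 (the hp4-generic entry
points the α package twins consume, so that ONE twin of each package file serves C4 and C7A alike). `--supports stmt-BirchSwinnertonDyer-20044` as a HELPER.
Theses-free; theorems only; no definition, no new fact, no `sorry`. Binders BY NAME where present: `hBT`, `hBF`, `hnew` (standing allow-list).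
FRONTIER-grade: twist-density-ZERO sub-families modulo named print; never distance-to-summit.

Each wrapper splits `p % 4 = 1` into `p % 8 = 5` (the landed lemma) and `p % 8 = 1` (its twin): `rank_eq_zero_and_sha_two_twoPosTwist[_pOneAlpha]`,
`selmerCorank_two_eq_zero_twoPosTwist[…]`, `analyticRank_eq_zero_twoPosTwist[…]`, `exists_LAlg_twoPosTwist[…]`, `rankZero_bsdTriple_twoPosTwist[…]`,
`lValue_twoPosTwist_mul_sqrt[…]` (all with the type-α hypothesis, idle at `p ≡ 5 (8)` where `49a1^{(2p)}` is `2`-minimal for both types), and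
`rank_eq_zero_and_sha_two_posTwist_of_symbol_neg[_pOne]`, `padicValNat_two_shaOrder_posTwist_of_symbol_neg[…]`, `analyticRank_eq_zero_posTwist_of_symbol_neg[…]`,
`exists_LAlg_posTwist_of_symbol_neg[…]`, `lValue_posTwist_mul_sqrt_of_alpha[_pOne]`.
HONEST FRAMING: bookkeeping only; items 19140 / 20044 unchanged; BSD is not proved by any of this.
-/

noncomputable section

open scoped Classical

open NumberField WeierstrassCurve Literature.NumberTheory.EllipticCurves
  Literature.NumberTheory.EllipticCurves.ModularForms
  Literature.NumberTheory.EllipticCurves.CaiShuTian2014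

namespace Summit.BirchSwinnertonDyer.BirchSwinnertonDyer.Theorems.GoldfeldGoodTwists

/-! ## §1 `49a1^{(2p)}`, type α, `p ≡ 1 (mod 4)` -/

section TwoPos
variable {p : ℕ} [Fact p.Prime]

/-- `rank = 0 ∧ Ш[2] = 0` for every model of `49a1^{(2p)}`, type α, `p ≡ 1 (4)`. [cite: SilvermanAEC2009, Thm. X.4.2(a), Prop. X.4.9] -/
theorem rank_eq_zero_and_sha_two_twoPosTwist_alpha_modFour (hp4 : p % 4 = 1) (hp7 : legendreSym p (-7) = 1)
    (hα : ¬ ∃ x : ZMod p, x ^ 4 = -7) (W : WeierstrassCurve ℚ) [W.IsElliptic] (C : VariableChange ℚ)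
    (hC : C • W = cm7.quadraticTwist ((2 * (p : ℤ) : ℤ) : ℚ)) :
    W.mordellWeilRank = 0 ∧ ∀ c ∈ W.sha, 2 • c = 0 → c = 0 := by
  rcases (show p % 8 = 1 ∨ p % 8 = 5 by omega) with h8 | h8
  · exact rank_eq_zero_and_sha_two_twoPosTwist_pOneAlpha h8 hp7 hα W C hC
  · exact rank_eq_zero_and_sha_two_twoPosTwist h8 hp7 W C hC

/-- `corank_{ℤ₂} Sel_{2^∞} = 0` for every model of `49a1^{(2p)}`, type α, `p ≡ 1 (4)`. [cite: SilvermanAEC2009, Thm. X.4.2(a), Prop. X.4.9] -/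
theorem selmerCorank_two_eq_zero_twoPosTwist_alpha_modFour (hp4 : p % 4 = 1) (hp7 : legendreSym p (-7) = 1)
    (hα : ¬ ∃ x : ZMod p, x ^ 4 = -7) (W : WeierstrassCurve ℚ) [W.IsElliptic] (C : VariableChange ℚ)
    (hC : C • W = cm7.quadraticTwist ((2 * (p : ℤ) : ℤ) : ℚ)) : W.selmerCorank 2 = 0 := by
  rcases (show p % 8 = 1 ∨ p % 8 = 5 by omega) with h8 | h8
  · exact selmerCorank_two_eq_zero_twoPosTwist_pOneAlpha h8 hp7 hα W C hC
  · exact selmerCorank_two_eq_zero_twoPosTwist h8 hp7 W C hC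

/-- `r_an(49a1^{(2p)}) = 0`, type α, `p ≡ 1 (4)`, granted `hBT`. [cite: BurungaleTian2026, Thm. 1.1] -/
theorem analyticRank_eq_zero_twoPosTwist_alpha_modFour
    (hBT : burungaleTian_analyticRank_eq_zero_of_selmerCorank_eq_zero_of_hasCM)
    (hp4 : p % 4 = 1) (hp7 : legendreSym p (-7) = 1) (hα : ¬ ∃ x : ZMod p, x ^ 4 = -7) (W : WeierstrassCurve ℚ) [W.IsElliptic]
    (C : VariableChange ℚ) (hC : C • W = cm7.quadraticTwist ((2 * (p : ℤ) : ℤ) : ℚ)) : W.analyticRank = 0 := by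
  rcases (show p % 8 = 1 ∨ p % 8 = 5 by omega) with h8 | h8
  · exact analyticRank_eq_zero_twoPosTwist_pOneAlpha hBT h8 hp7 hα W C hC
  · exact analyticRank_eq_zero_twoPosTwist hBT h8 hp7 W C hC

/-- `L(W′,1) = q·Ω_∞(W′)`, `q ≠ 0`, `ord₂ q = 3` for every globally minimal `W′ ≅ 49a1^{(2p)}`, type α, `p ≡ 1 (4)`. [cite: BurungaleFlach2024, Cor. 2]
[cite: BurungaleTian2026, Thm. 1.1] -/
theorem exists_LAlg_twoPosTwist_alpha_modFour
    (hBT : burungaleTian_analyticRank_eq_zero_of_selmerCorank_eq_zero_of_hasCM)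
    (hBF : bsdTriple_of_hasCM_of_L_one_ne_zero) (hnew : exists_isNewformOf)
    (hp4 : p % 4 = 1) (hp7 : legendreSym p (-7) = 1) (hα : ¬ ∃ x : ZMod p, x ^ 4 = -7)
    (W' : WeierstrassCurve ℚ) [W'.IsElliptic] [W'.IsGloballyMinimal]
    (hC : ∃ C : VariableChange ℚ, C • W' = cm7.quadraticTwist ((2 * (p : ℤ) : ℤ) : ℚ)) :
    ∃ q : ℚ, W'.entireLFunction 1 = ((q * CoatesLiTianZhai2015.leastRealPeriod W' : ℝ) : ℂ) ∧ q ≠ 0 ∧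
      padicValRat 2 q = 3 := by
  rcases (show p % 8 = 1 ∨ p % 8 = 5 by omega) with h8 | h8
  · exact exists_LAlg_twoPosTwist_pOneAlpha hBT hBF hnew h8 hp7 hα W' hC
  · exact exists_LAlg_twoPosTwist hBT hBF hnew h8 hp7 W' hC

/-- The rank-`0` BSD package for every globally minimal `W′ ≅ 49a1^{(2p)}`, type α, `p ≡ 1 (4)`. [cite: BurungaleFlach2024, Cor. 2] [cite: BurungaleTian2026, Thm. 1.1] -/
theorem rankZero_bsdTriple_twoPosTwist_alpha_modFour
    (hBT : burungaleTian_analyticRank_eq_zero_of_selmerCorank_eq_zero_of_hasCM)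
    (hBF : bsdTriple_of_hasCM_of_L_one_ne_zero) (hnew : exists_isNewformOf)
    (hp4 : p % 4 = 1) (hp7 : legendreSym p (-7) = 1) (hα : ¬ ∃ x : ZMod p, x ^ 4 = -7)
    (W' : WeierstrassCurve ℚ) [W'.IsElliptic] [W'.IsGloballyMinimal]
    (hC : ∃ C : VariableChange ℚ, C • W' = cm7.quadraticTwist ((2 * (p : ℤ) : ℤ) : ℚ)) :
    W'.analyticRank = 0 ∧ W'.entireLFunction 1 ≠ 0 ∧ W'.BSDTriple ∧ W'.ShaFinite ∧ Odd W'.shaOrder ∧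
      W'.tamagawaProduct = 32 := by
  rcases (show p % 8 = 1 ∨ p % 8 = 5 by omega) with h8 | h8
  · exact rankZero_bsdTriple_twoPosTwist_pOneAlpha hBT hBF hnew h8 hp7 hα W' hC
  · exact rankZero_bsdTriple_twoPosTwist hBT hBF hnew h8 hp7 W' hC

/-- `L(49a1^{(2p)}, 1)·√(8p) = r·Ω(49a1)`, `ord₂ r = 3`, `r ≠ 0`, type α, `p ≡ 1 (4)`. [cite: BurungaleFlach2024, Thm. 1.1] [cite: BurungaleTian2026, Thm. 1.1]
[cite: Pal2012, Thm. 3.2] -/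
theorem lValue_twoPosTwist_mul_sqrt_alpha_modFour (hBT : burungaleTian_analyticRank_eq_zero_of_selmerCorank_eq_zero_of_hasCM)
    (hBF : bsdTriple_of_hasCM_of_L_one_ne_zero) (hnew : exists_isNewformOf) (hp4 : p % 4 = 1) (hp7 : legendreSym p (-7) = 1)
    (hα : ¬ ∃ x : ZMod p, x ^ 4 = -7) (W₂ : WeierstrassCurve ℚ) [W₂.IsElliptic] [W₂.IsGloballyMinimal]
    (hC : ∃ C : VariableChange ℚ, C • W₂ = cm7.quadraticTwist ((2 * (p : ℤ) : ℤ) : ℚ)) :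
    ∃ r : ℚ, padicValRat 2 r = 3 ∧ r ≠ 0 ∧
      W₂.entireLFunction 1 * (Real.sqrt (8 * p) : ℂ) = ((r : ℝ) * cm7.realPeriodRat : ℝ) := by
  rcases (show p % 8 = 1 ∨ p % 8 = 5 by omega) with h8 | h8
  · exact lValue_twoPosTwist_mul_sqrt_pOneAlpha hBT hBF hnew h8 hp7 hα W₂ hC
  · exact lValue_twoPosTwist_mul_sqrt hBT hBF hnew h8 hp7 W₂ hC

end TwoPos

/-! ## §2 `49a1^{(p)}`, `σ(p) = −1` (type α), `p ≡ 1 (mod 4)` -/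

section Pos
variable {l : ℕ} [Fact l.Prime]

/-- `rank = 0 ∧ Ш[2] = 0` for every model of `49a1^{(ℓ)}`, `σ(ℓ) = −1`, `ℓ ≡ 1 (4)`. [cite: SilvermanAEC2009, Thm. X.4.2(a), Prop. X.4.9] -/
theorem rank_eq_zero_and_sha_two_posTwist_of_symbol_neg_modFour (hl4 : l % 4 = 1) (hl7 : legendreSym l (-7) = 1)
    (hσ : ∀ s : ZMod l, s ^ 2 = -7 → ¬ IsSquare (2 * (s - 21))) (W : WeierstrassCurve ℚ) [W.IsElliptic]
    (C : VariableChange ℚ) (hC : C • W = cm7.quadraticTwist ((l : ℤ) : ℚ)) :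
    W.mordellWeilRank = 0 ∧ ∀ c ∈ W.sha, 2 • c = 0 → c = 0 := by
  rcases (show l % 8 = 1 ∨ l % 8 = 5 by omega) with h8 | h8
  · exact rank_eq_zero_and_sha_two_posTwist_of_symbol_neg_pOne h8 hl7 hσ W C hC
  · exact rank_eq_zero_and_sha_two_posTwist_of_symbol_neg h8 hl7 hσ W C hC

/-- `#Ш(W′)` odd for `W′ ≅ 49a1^{(ℓ)}`, `σ(ℓ) = −1`, `ℓ ≡ 1 (4)`, finite `Ш`. [cite: SilvermanAEC2009, Thm. X.4.2(a), Prop. X.4.9] -/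
theorem padicValNat_two_shaOrder_posTwist_of_symbol_neg_modFour (hl4 : l % 4 = 1) (hl7 : legendreSym l (-7) = 1)
    (hσ : ∀ s : ZMod l, s ^ 2 = -7 → ¬ IsSquare (2 * (s - 21)))
    (W' : WeierstrassCurve ℚ) [W'.IsElliptic] (C : VariableChange ℚ) (hC : C • W' = cm7.quadraticTwist ((l : ℤ) : ℚ))
    [Finite W'.sha] : padicValNat 2 W'.shaOrder = 0 := by
  rcases (show l % 8 = 1 ∨ l % 8 = 5 by omega) with h8 | h8
  · exact padicValNat_two_shaOrder_posTwist_of_symbol_neg_pOne h8 hl7 hσ W' C hC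
  · exact padicValNat_two_shaOrder_posTwist_of_symbol_neg h8 hl7 hσ W' C hC

/-- `r_an(49a1^{(ℓ)}) = 0`, `σ(ℓ) = −1`, `ℓ ≡ 1 (4)`, granted `hBT`. [cite: BurungaleTian2026, Thm. 1.1] -/
theorem analyticRank_eq_zero_posTwist_of_symbol_neg_modFour
    (hBT : burungaleTian_analyticRank_eq_zero_of_selmerCorank_eq_zero_of_hasCM)
    (hl4 : l % 4 = 1) (hl7 : legendreSym l (-7) = 1) (hσ : ∀ s : ZMod l, s ^ 2 = -7 → ¬ IsSquare (2 * (s - 21)))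
    (W : WeierstrassCurve ℚ) [W.IsElliptic] (C : VariableChange ℚ) (hC : C • W = cm7.quadraticTwist ((l : ℤ) : ℚ)) :
    W.analyticRank = 0 := by
  rcases (show l % 8 = 1 ∨ l % 8 = 5 by omega) with h8 | h8
  · exact analyticRank_eq_zero_posTwist_of_symbol_neg_pOne hBT h8 hl7 hσ W C hC
  · exact analyticRank_eq_zero_posTwist_of_symbol_neg hBT h8 hl7 hσ W C hC

/-- `L(W′,1) = q·Ω_∞(W′)`, `q ≠ 0`, `ord₂ q = 1` for globally minimal `W′ ≅ 49a1^{(ℓ)}`, `σ(ℓ) = −1`, `ℓ ≡ 1 (4)`. [cite: BurungaleFlach2024, Cor. 2]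
[cite: BurungaleTian2026, Thm. 1.1] -/
theorem exists_LAlg_posTwist_of_symbol_neg_modFour
    (hBT : burungaleTian_analyticRank_eq_zero_of_selmerCorank_eq_zero_of_hasCM)
    (hBF : bsdTriple_of_hasCM_of_L_one_ne_zero) (hnew : exists_isNewformOf)
    (hl4 : l % 4 = 1) (hl7 : legendreSym l (-7) = 1) (hσ : ∀ s : ZMod l, s ^ 2 = -7 → ¬ IsSquare (2 * (s - 21)))
    (W' : WeierstrassCurve ℚ) [W'.IsElliptic] [W'.IsGloballyMinimal]
    (hC : ∃ C : VariableChange ℚ, C • W' = cm7.quadraticTwist (l : ℚ)) :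
    ∃ q : ℚ, W'.entireLFunction 1 = ((q * CoatesLiTianZhai2015.leastRealPeriod W' : ℝ) : ℂ) ∧ q ≠ 0 ∧
      padicValRat 2 q = 1 := by
  rcases (show l % 8 = 1 ∨ l % 8 = 5 by omega) with h8 | h8
  · exact exists_LAlg_posTwist_of_symbol_neg_pOne hBT hBF hnew h8 hl7 hσ W' hC
  · exact exists_LAlg_posTwist_of_symbol_neg hBT hBF hnew h8 hl7 hσ W' hC

end Pos

section PosAlpha
variable {p : ℕ} [Fact p.Prime]

/-- `L(49a1^{(p)}, 1)·√p = r·Ω(49a1)`, `r ≠ 0`, `ord₂ r = 1`, type α, `p ≡ 1 (4)`. [cite: BurungaleFlach2024, Cor. 2] [cite: BurungaleTian2026, Thm. 1.1]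
[cite: Pal2012, Thm. 3.2 (case d > 0)] -/
theorem lValue_posTwist_mul_sqrt_of_alpha_modFour (hBT : burungaleTian_analyticRank_eq_zero_of_selmerCorank_eq_zero_of_hasCM)
    (hBF : bsdTriple_of_hasCM_of_L_one_ne_zero) (hnew : exists_isNewformOf) (hp4 : p % 4 = 1) (hp7 : legendreSym p (-7) = 1)
    (hα : ¬ ∃ x : ZMod p, x ^ 4 = -7) (Wp : WeierstrassCurve ℚ) [Wp.IsElliptic] [Wp.IsGloballyMinimal]
    (hC : ∃ C : VariableChange ℚ, C • Wp = cm7.quadraticTwist (p : ℚ)) :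
    ∃ r : ℚ, r ≠ 0 ∧ padicValRat 2 r = 1 ∧ Wp.entireLFunction 1 * (Real.sqrt p : ℂ) = ((r : ℝ) * cm7.realPeriodRat : ℝ) := by
  rcases (show p % 8 = 1 ∨ p % 8 = 5 by omega) with h8 | h8
  · exact lValue_posTwist_mul_sqrt_of_alpha_pOne hBT hBF hnew h8 hp7 hα Wp hC
  · exact lValue_posTwist_mul_sqrt_of_alpha hBT hBF hnew h8 hp7 hα Wp hC

end PosAlpha

end Summit.BirchSwinnertonDyer.BirchSwinnertonDyer.Theorems.GoldfeldGoodTwists
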